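import Summits.BirchSwinnertonDyer.BirchSwinnertonDyer.Theorems.RamifiedHeegnerPairLeafRankOneUpperAtThreeLeafTwistStable
import Summits.BirchSwinnertonDyer.BirchSwinnertonDyer.Theorems.RamifiedHeegnerPairRamifiedPairUpperBoundRankOneMemberIrreducible
import Literature.NumberTheory.EllipticCurves.NonvanishingTwistsPrescribedSplitting
import Literature.NumberTheory.EllipticCurves.HeegnerPointsRationalityProofs
import Literature.NumberTheory.EllipticCurves.HeegnerPointsClassesProofs
import Literature.NumberTheory.EllipticCurves.HeegnerPointsProofs
import Literature.NumberTheory.EllipticCurves.RootNumberEvenAnalyticRankProofs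
import HarnessLib

/-!
# Route `RamifiedHeegnerPair`, crux U₁ `LeafRankOneUpperAtThree` (stmt-BirchSwinnertonDyer-26022), line `splitkolyvagin` —
# the COMPOSITION as a theorem (PUB → Σ → L₀ → U₁) and the Tamagawa-free rows, where Σ is vacuous (U₁ ⟸ PUB + L₀,
# image-free)

HONEST FRAMING. Theorems only; helper file (`--supports stmt-BirchSwinnertonDyer-26022 --as helper`); nothing is booked,
no item is closed, BSD is not proved for any curve; CONDITIONAL on every displayed input. The crux U₁ (the rank-one
UPPER member half of `BSD₃` on the W-ALL leaf Gss2 at `3`, route rev 7) is cut by the registered skeleton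
`Cruxes/LeafRankOneUpperAtThree/Lines/splitkolyvagin.lean` (15efc49b) into PUB (print) + Σ (open core: Σ-form global
`3`-divisibility of derived Heegner points at the additive `3`, Manin-robust, image-free) + L₀ (route item 26023
`Gss2LowerAtThreeRankZero` BY NAME). This file lands the composition itself as a kernel theorem, so that a later split of
26022 into «Σ» + «L₀ by name» + glue closes its glue item by `fun a b c ↦ …`, and records the rows where Σ costs nothing:

* `leafRankOneUpperAtThree_of_pub_of_sigma_of_lowerRankZero` — PUB → Σ → `Gss2LowerAtThreeRankZero` →
  `LeafRankOneUpperAtThree` (conclusion literally the route decl). Field: Friedberg–Hoffstein 1995 Thm. B with every prime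
  of `N_E` and `2` split (`d_{K′}` odd; `L(E^{(d_{K′})},1) ≠ 0`); Heegner datum and `K′`-rational Heegner point of a
  parametrisation datum (tree theorems `exists_dvd_sq_sub_discr_holds`, `nonempty_heegnerDatum_holds`,
  `heegnerPointComplex_mem_range_map_holds`); the globally minimal twist is a non-CM LEAF curve of analytic rank `0`
  (`RamifiedPairUpperBound.leaf_twist_of_heegner`), so L₀ pays its lower half; Σ at that datum feeds p607279's
  `leafRankOneUpper_three_of_globalDivisibility_of_twistLower` (receptacle + p606327 §2).
* `leafRankOneUpper_three_tamFree_of_pub_of_lowerRankZero` — the TAMAGAWA-FREE rows, IMAGE-FREE: for a non-CM leaf `W` of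
  analytic rank one with `3 ∤ ∏_ℓ c_ℓ(W)` and a parametrisation datum at level `N_E` with `3 ∤ c`, the depth
  `ord₃ ∏c_ℓ + v₃(c)` of Σ is `0` and `3⁰ ∣ P_n` is trivial, so `Typed.MissingUpperBoundAt W 3` ⟸ PUB (without
  the parametrisation-existence conjunct) + L₀. Compared with p606327 §3 (Kolyvagin 1990 + `ρ̄_{E,3}` onto) the
  surjectivity binder is GONE (Matar–Nekovář's irreducible form; `E[3]` is irreducible on the leaf).

Lead prover bsd-line-rhp-p2 g3, 2026-08-28. References: [cite: FriedbergHoffstein1995, Thm. B] [cite: MatarNekovar2019,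
Thm. 0.7 (p. 456) and §0.11 (p. 457)] [cite: Jetchev2008, Conj. 1.3 and Thm. 1.4 (p. 812)] [cite: GrossZagier1986, Thm. I.(6.3)
and (7.3)] [cite: Miller2011LMS, §1 and Def. 1.1].
-/

-- D-0017: single-problem summit, so `Summit.BirchSwinnertonDyer.BirchSwinnertonDyer.…` repeats a namespace BY DESIGN.
set_option linter.dupNamespace false
set_option autoImplicit false

noncomputable section

open scoped Classical NumberField

open WeierstrassCurve IsDedekindDomain IsDedekindDomain.HeightOneSpectrum NumberField
  Rat.HeightOneSpectrum Literature Literature.NumberTheory.EllipticCurves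
  Literature.NumberTheory.EllipticCurves.ModularForms
  Literature.NumberTheory.EllipticCurves.Rank1Residual
  Literature.NumberTheory.EllipticCurves.Rank1Residual.Typed
  Literature.NumberTheory.EllipticCurves.KrizLi2019
  Literature.NumberTheory.QuadraticFields
  Summit.BirchSwinnertonDyer.Rank1Residual
  Summit.BirchSwinnertonDyer.Rank1Residual.Additive
  Summit.BirchSwinnertonDyer.Rank1Residual.X11b.Three
  Summit.BirchSwinnertonDyer.BirchSwinnertonDyer.Theses.RamifiedHeegnerPair
  Summit.BirchSwinnertonDyer.BirchSwinnertonDyer.Theorems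
  Summit.BirchSwinnertonDyer.BirchSwinnertonDyer.Theorems.SchneiderFree

namespace Summit.BirchSwinnertonDyer.BirchSwinnertonDyer.Theorems.RamifiedPairUpperBound

/-! ## §1 One datum: the Friedberg–Hoffstein split field of a rank-one leaf curve and what Σ at it buys -/

/-- **U₁ AT `W` from Σ AT ONE PARAMETRISATION DATUM** (the composition at the data level). For a non-CM leaf `W`
(`Addv W 3`, `SubGss W 3`) of analytic rank one and a parametrisation datum `Dt` at level `N_E`: IF for every imaginary
quadratic `K′` of odd discriminant with the Heegner hypothesis for `N_E` and `L(W^{(d_{K′})},1) ≠ 0`, every Heegner datum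
`H`, `ι`, and the Heegner point `P` (non-torsion), the derived Heegner points on the frame `(Dt, H.β, ι)` are
`3^{s′}`-divisible for all `s′ ≤ ord₃ ∏c_ℓ(W) + v₃(c(Dt))` (`hSig`, Σ at `Dt`), and every non-CM rank-ZERO leaf curve has
its lower half (`hL0` = item 26023), THEN `Typed.MissingUpperBoundAt W 3` — given the printed facts. The field is
Friedberg–Hoffstein's (`2` and every `ℓ ∣ N_E` split), the twist is a leaf curve (`leaf_twist_of_heegner`), the rest is
p607279. [cite: FriedbergHoffstein1995, Thm. B] [cite: MatarNekovar2019, Thm. 0.7 (p. 456)] [cite: Jetchev2008, Conj. 1.3]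
[cite: GrossZagier1986, Thm. I.(6.3) and (7.3)] [cite: Miller2011LMS, Def. 1.1] -/
theorem leafRankOneUpper_three_of_sigmaAtDatum_of_lowerRankZero
    (hGZ : ∀ (N : ℕ) [NeZero N] (W : WeierstrassCurve ℚ) (K : Type) [Field K] [NumberField K],
      gross_zagier N W K)
    (hKo : ∀ (N : ℕ) [NeZero N] (W : WeierstrassCurve ℚ) (K : Type) [Field K] [NumberField K],
      kolyvagin N W K)
    (hGZK : rank_eq_analyticRank_of_analyticRank_le_one) (hmod : hasEntireLFunction_rat)
    (hGZ73 : GrossZagier1986_thm_I_7_3)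
    (hMN : MatarNekovar2019.thm07_padicValNat_card_sha_primary_add_le_of_globalDivisibility_of_irreducible)
    (hnf : exists_isNewformOf) (hFH : friedbergHoffstein_exists_heegnerField_splitDivisors_twist_ne_zero)
    (hL0 : Gss2LowerAtThreeRankZero)
    (W : WeierstrassCurve ℚ) [W.IsElliptic] [W.IsGloballyMinimal] [NeZero (W.conductorNorm ℤ)]
    (hCM : ¬ W.HasCM) (hadd : Addv W 3) (hsub : SubGss W 3) (hr : W.analyticRank = 1)
    (Dt : ModularParametrizationData W (W.conductorNorm ℤ))
    (hSig : ∀ (K : Type) [Field K] [NumberField K]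
      (H : HeegnerDatum (W.conductorNorm ℤ) (NumberField.discr K)) (ι : K →+* ℂ) (P : (W.baseChange K).toAffine.Point),
      IsImaginaryQuadratic K → SatisfiesHeegnerHypothesis (W.conductorNorm ℤ) K →
      (W.quadraticTwist (NumberField.discr K : ℚ)).entireLFunction 1 ≠ 0 →
      WeierstrassCurve.Affine.Point.map ι.toRatAlgHom P = heegnerPointComplex Dt H → ¬ IsOfFinAddOrder P →
      Odd (NumberField.discr K) →
      ∀ (s' : ℕ), s' ≤ padicValNat 3 W.tamagawaProduct + padicValNat 3 Dt.c.natAbs →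
      ∀ (n : ℕ) (d : KolyvaginHeegnerData Dt H.β ι n), Squarefree n →
      (∀ ℓ ∈ n.primeFactors, Zhang2014.IsKolyvaginPrime (W.conductorNorm ℤ) W K 3 ℓ ∧
        s' ≤ Zhang2014.kolyvaginIndex W 3 ℓ) → Koly.PDiv d 3 s') :
    MissingUpperBoundAt W 3 := by
  -- the sign of the functional equation is `−1` (modularity, `r_an = 1`)
  have hw : W.rootNumber = -1 := by
    rw [WeierstrassCurve.rootNumber_eq_neg_one_pow_analyticRank_of_exists_isNewformOf hnf W, hr]
    norm_num
  -- the Friedberg–Hoffstein field: every `ℓ ∣ N_E` and `ℓ = 2` split, `L(E^{(d_K)},1) ≠ 0`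
  obtain ⟨K, _, _, hK, -, hHN, hH2, hLt⟩ := hFH W hw 2 two_ne_zero 4
  have hodd : Odd (NumberField.discr K) := by
    have h2 : ¬ ((2 : ℕ) : ℤ) ∣ NumberField.discr K :=
      Literature.SatisfiesHeegnerHypothesis.not_dvd_discr hK.1 hH2 Nat.prime_two (dvd_refl 2)
    rw [← Int.not_even_iff_odd, even_iff_two_dvd]
    exact_mod_cast h2
  -- the Heegner datum and the `K`-rational Heegner point of `Dt`
  obtain ⟨β, hβ⟩ := exists_dvd_sq_sub_discr_holds (W.conductorNorm ℤ) K hK hHN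
  obtain ⟨H, -⟩ := nonempty_heegnerDatum_holds (W.conductorNorm ℤ) K hK hβ
  obtain ⟨ι⟩ : Nonempty (K →+* ℂ) := inferInstance
  obtain ⟨P, hP⟩ := heegnerPointComplex_mem_range_map_holds (W.conductorNorm ℤ) W K hK hHN Dt H ι
  -- a globally minimal model of the twist: a non-CM LEAF curve of analytic rank `0`, so L₀ applies
  have hD0 : (NumberField.discr K : ℚ) ≠ 0 := by exact_mod_cast NumberField.discr_ne_zero K
  haveI hEt : (W.quadraticTwist (NumberField.discr K : ℚ)).IsElliptic := W.isElliptic_quadraticTwist hD0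
  obtain ⟨Cd, hCd⟩ := hasGlobalMinimalModel_rat_holds (W.quadraticTwist (NumberField.discr K : ℚ))
  haveI : (Cd • W.quadraticTwist (NumberField.discr K : ℚ)).IsGloballyMinimal := hCd
  have hrd : (Cd • W.quadraticTwist (NumberField.discr K : ℚ)).analyticRank = 0 := by
    rw [analyticRank_smul]
    exact analyticRank_eq_zero_of_entireLFunction_one_ne_zero _ hLt
  obtain ⟨hCMd, haddd, hsubd, -⟩ := leaf_twist_of_heegner W hCM hadd hsub K hK hHN hodd
    (Cd • W.quadraticTwist (NumberField.discr K : ℚ)) Cd rfl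
  have hlow : MissingLowerBoundAt (Cd • W.quadraticTwist (NumberField.discr K : ℚ)) 3 :=
    hL0 _ hCMd haddd hsubd hrd
  -- the Heegner point is non-torsion (Gross–Zagier: `L′(E/K,1) = L′(E,1)·L(E^{(d_K)},1) ≠ 0`)
  have hL0W : W.entireLFunction 1 = 0 := entireLFunction_one_eq_zero_of_analyticRank_eq_one hr
  obtain ⟨-, hderiv⟩ := leadingLCoeff_eq_deriv_of_analyticRank_eq_one hr
  have hLK : LDerivEK W K ≠ 0 := by
    rw [lDerivEK_eq_deriv_mul W K hmod hL0W]; exact mul_ne_zero hderiv hLt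
  have hnt : ¬ IsOfFinAddOrder P :=
    (lDerivEK_ne_zero_iff_not_isOfFinAddOrder W (W.conductorNorm ℤ) K (hGZ _ W K) hK hHN
      ⟨Dt, H, ι, hP⟩).mp hLK
  -- Σ at this datum ⟹ the socket (p607279's receptacle) ⟹ the upper half (p606327 §2)
  exact leafRankOneUpper_three_of_globalDivisibility_of_twistLower hGZ hKo hGZK hmod hGZ73 hMN W hCM hadd hsub hr
    K Dt H ι P (Cd • W.quadraticTwist (NumberField.discr K : ℚ)) hK hodd hHN hLt hP ⟨Cd, rfl⟩
    (fun s' hs' n d hn hℓ ↦ hSig K H ι P hK hHN hLt hP hnt hodd s' hs' n d hn hℓ) hlow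

/-! ## §2 The composition PUB → Σ → L₀ → U₁ (the registered skeleton's `LeafRankOneUpperAtThree_of`, as a tree theorem) -/

/-- **`LeafRankOneUpperAtThree` ⟸ PUB + Σ + L₀** (conclusion literally the route decl; the hypotheses are the three
registered stubs of `Cruxes/LeafRankOneUpperAtThree/Lines/splitkolyvagin.lean` 15efc49b, verbatim). PUB = the printed
inputs as the tree's named facts; Σ = the Σ-form global `3`-divisibility of derived Heegner points at the additive `3`
on the leaf (THE OPEN CORE); L₀ = route item 26023 `Gss2LowerAtThreeRankZero`. If the planner splits 26022 into these,
this theorem closes the glue. [cite: FriedbergHoffstein1995, Thm. B] [cite: MatarNekovar2019, Thm. 0.7 (p. 456)]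
[cite: Jetchev2008, Conj. 1.3] [cite: GrossZagier1986, Thm. I.(6.3) and (7.3)] [cite: Miller2011LMS, Def. 1.1] -/
theorem leafRankOneUpperAtThree_of_pub_of_sigma_of_lowerRankZero
    (hpub : (∀ (N : ℕ) [NeZero N] (W : WeierstrassCurve ℚ) (K : Type) [Field K] [NumberField K],
        Literature.NumberTheory.EllipticCurves.gross_zagier N W K) ∧
      (∀ (N : ℕ) [NeZero N] (W : WeierstrassCurve ℚ) (K : Type) [Field K] [NumberField K],
        Literature.NumberTheory.EllipticCurves.kolyvagin N W K) ∧
      Literature.NumberTheory.EllipticCurves.rank_eq_analyticRank_of_analyticRank_le_one ∧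
      WeierstrassCurve.hasEntireLFunction_rat ∧
      Literature.NumberTheory.EllipticCurves.GrossZagier1986_thm_I_7_3 ∧
      Literature.NumberTheory.EllipticCurves.MatarNekovar2019.thm07_padicValNat_card_sha_primary_add_le_of_globalDivisibility_of_irreducible ∧
      Literature.NumberTheory.EllipticCurves.ModularForms.exists_isNewformOf ∧
      Literature.NumberTheory.EllipticCurves.friedbergHoffstein_exists_heegnerField_splitDivisors_twist_ne_zero ∧
      Literature.NumberTheory.EllipticCurves.ModularForms.nonempty_modularParametrizationData)
    (hSig : ∀ (W : WeierstrassCurve ℚ) [W.IsElliptic] [W.IsGloballyMinimal] (N : ℕ) [NeZero N]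
      (K : Type) [Field K] [NumberField K]
      (Dt : Literature.NumberTheory.EllipticCurves.ModularForms.ModularParametrizationData W N)
      (H : Literature.NumberTheory.EllipticCurves.HeegnerDatum N (NumberField.discr K)) (ι : K →+* ℂ)
      (P : (W.baseChange K).toAffine.Point),
      ¬ W.HasCM → Literature.NumberTheory.EllipticCurves.Rank1Residual.Addv W 3 →
      Summit.BirchSwinnertonDyer.Rank1Residual.Additive.SubGss W 3 → W.analyticRank = 1 →
      W.conductorNorm ℤ = N → Literature.NumberTheory.EllipticCurves.IsImaginaryQuadratic K →
      Literature.NumberTheory.EllipticCurves.SatisfiesHeegnerHypothesis N K →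
      (W.quadraticTwist (NumberField.discr K : ℚ)).entireLFunction 1 ≠ 0 →
      (WeierstrassCurve.Affine.Point.map ι.toRatAlgHom) P =
        Literature.NumberTheory.EllipticCurves.ModularForms.heegnerPointComplex Dt H →
      ¬ IsOfFinAddOrder P → Odd (NumberField.discr K) →
      ∀ (s' : ℕ), s' ≤ padicValNat 3 W.tamagawaProduct + padicValNat 3 Dt.c.natAbs →
      ∀ (n : ℕ) (d : Literature.NumberTheory.EllipticCurves.KolyvaginHeegnerData Dt H.β ι n), Squarefree n →
      (∀ ℓ ∈ n.primeFactors, Literature.NumberTheory.EllipticCurves.Zhang2014.IsKolyvaginPrime N W K 3 ℓ ∧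
        s' ≤ Literature.NumberTheory.EllipticCurves.Zhang2014.kolyvaginIndex W 3 ℓ) →
      Summit.BirchSwinnertonDyer.Rank1Residual.X11b.Three.Koly.PDiv d 3 s')
    (hL0 : Summit.BirchSwinnertonDyer.BirchSwinnertonDyer.Theses.RamifiedHeegnerPair.Gss2LowerAtThreeRankZero) :
    Summit.BirchSwinnertonDyer.BirchSwinnertonDyer.Theses.RamifiedHeegnerPair.LeafRankOneUpperAtThree := by
  intro W _ _ hCM hadd hsub hr
  obtain ⟨hGZ, hKo, hGZK, hmod, hGZ73, hMN, hnf, hFH, hMP⟩ := hpub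
  haveI : NeZero (W.conductorNorm ℤ) := ⟨(Nat.pos_iff_ne_zero.mp W.conductorNorm_pos_holds)⟩
  obtain ⟨Dt⟩ := hMP W
  exact leafRankOneUpper_three_of_sigmaAtDatum_of_lowerRankZero hGZ hKo hGZK hmod hGZ73 hMN hnf hFH hL0 W hCM hadd
    hsub hr Dt (fun K _ _ H ι P hK hHN hLt hP hnt hodd s' hs' n d hn hℓ ↦
      hSig W (W.conductorNorm ℤ) K Dt H ι P hCM hadd hsub hr rfl hK hHN hLt hP hnt hodd s' hs' n d hn hℓ)

/-! ## §3 The Tamagawa-free rows: Σ is vacuous, so U₁ ⟸ PUB + L₀ — image-free -/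

/-- **Depth zero is free**: every derived Heegner point is `3⁰`-divisible. [folklore] -/
theorem koly_pDiv_zero {N : ℕ} [NeZero N] {W : WeierstrassCurve ℚ} {K : Type} [Field K] [NumberField K]
    {Dt : ModularParametrizationData W N} {β : ℤ} {ι : K →+* ℂ} {n : ℕ} (d : KolyvaginHeegnerData Dt β ι n)
    (p : ℕ) : Koly.PDiv d p 0 :=
  ⟨d.derivedPoint, by rw [pow_zero, Nat.cast_one, one_zsmul]⟩

/-- **U₁ on the TAMAGAWA-FREE rows, IMAGE-FREE: PUB + L₀.** For a non-CM leaf curve `W` (`Addv W 3`, `SubGss W 3`) of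
analytic rank one with `3 ∤ ∏_ℓ c_ℓ(W)` and a parametrisation datum at level `N_E` with `3 ∤ c` (the census's 9
Tamagawa-free rank-one Gss2 classes, Manin constant `1` in Cremona's range): the depth of Σ is `0`, so
`Typed.MissingUpperBoundAt W 3` follows from the printed facts (Gross–Zagier, Kolyvagin, GZK, modularity, GZ I.7.3,
Matar–Nekovář 2019 Thm. 0.7 — NO surjectivity of `ρ̄_{E,3}`, unlike p606327 §3 —, newform, Friedberg–Hoffstein) and the
LOWER half of the rank-zero leaf curves (route item 26023). [cite: MatarNekovar2019, Thm. 0.7 (p. 456) and §0.11 (p. 457)]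
[cite: FriedbergHoffstein1995, Thm. B] [cite: GrossZagier1986, Thm. I.(6.3) and (7.3)] [cite: Miller2011LMS, Def. 1.1] -/
theorem leafRankOneUpper_three_tamFree_of_pub_of_lowerRankZero
    (hGZ : ∀ (N : ℕ) [NeZero N] (W : WeierstrassCurve ℚ) (K : Type) [Field K] [NumberField K],
      gross_zagier N W K)
    (hKo : ∀ (N : ℕ) [NeZero N] (W : WeierstrassCurve ℚ) (K : Type) [Field K] [NumberField K],
      kolyvagin N W K)
    (hGZK : rank_eq_analyticRank_of_analyticRank_le_one) (hmod : hasEntireLFunction_rat)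
    (hGZ73 : GrossZagier1986_thm_I_7_3)
    (hMN : MatarNekovar2019.thm07_padicValNat_card_sha_primary_add_le_of_globalDivisibility_of_irreducible)
    (hnf : exists_isNewformOf) (hFH : friedbergHoffstein_exists_heegnerField_splitDivisors_twist_ne_zero)
    (hL0 : Gss2LowerAtThreeRankZero)
    (W : WeierstrassCurve ℚ) [W.IsElliptic] [W.IsGloballyMinimal] [NeZero (W.conductorNorm ℤ)]
    (hCM : ¬ W.HasCM) (hadd : Addv W 3) (hsub : SubGss W 3) (hr : W.analyticRank = 1)
    (htam : ¬ 3 ∣ W.tamagawaProduct)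
    (Dt : ModularParametrizationData W (W.conductorNorm ℤ)) (hc : ¬ (3 : ℤ) ∣ Dt.c) :
    MissingUpperBoundAt W 3 := by
  have ht0 : padicValNat 3 W.tamagawaProduct = 0 := padicValNat.eq_zero_of_not_dvd htam
  have hc0 : padicValNat 3 Dt.c.natAbs = 0 :=
    padicValNat.eq_zero_of_not_dvd fun h ↦ hc (Int.ofNat_dvd_left.mpr h)
  refine leafRankOneUpper_three_of_sigmaAtDatum_of_lowerRankZero hGZ hKo hGZK hmod hGZ73 hMN hnf hFH hL0 W hCM hadd
    hsub hr Dt ?_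
  intro K _ _ H ι P _ _ _ _ _ _ s' hs' n d _ _
  have hs0 : s' = 0 := by omega
  subst hs0
  exact koly_pDiv_zero d 3

end Summit.BirchSwinnertonDyer.BirchSwinnertonDyer.Theorems.RamifiedPairUpperBound

end
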